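import Literature.MathematicalPhysics.MHD.GradShafranov
import Literature.MathematicalPhysics.MHD.GradShafranovSqrtTransform
import HarnessLib

/-!
# The `√R` (Liouville) substitution for the Grad–Shafranov OPERATOR: pointwise form

Topic `Literature/MathematicalPhysics/MHD`. For the Grad–Shafranov operator
`Δ*ψ = R∂_R(R⁻¹∂_Rψ) + ∂²_Zψ` (Freidberg, *Ideal MHD* (2014) eq. (6.7); `GradShafranov.gsOperator`) the
classical substitution `ψ = √R·w` gives, POINTWISE at every `R > 0`,

  `Δ*(√R·w) = √R · (w_RR + w_ZZ − (3/4) R⁻² w)`,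

i.e. `Δ*` is conjugate to the Schrödinger-type operator `Δ − 3/(4R²)` (flat two-dimensional Laplacian in
`(R, Z)`). This is the Liouville transformation of the radial Sturm–Liouville part `(R⁻¹y′)′` of `Δ*`
(coefficients `p = w = 1/R`, `q = 0`; new dependent variable `Y = R^{-1/2}y`, new coefficient `Q = 3/(4R²)`):
W. N. Everitt, *A catalogue of Sturm–Liouville differential equations*, §7, in Amrein–Hinz–Pearson (eds.),
*Sturm–Liouville Theory: Past and Present* (Birkhäuser 2005). The companion file
`GradShafranovSqrtTransform.lean` (certnum-ode-3) proves the ENERGY (weak) form of the same substitution and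
deliberately not this operator identity; this file supplies it, because the validated-numerics enclosure of
Grad–Shafranov equilibria on a conformal chart (certnum-ode-2, pub/certnum/ode/F2-ROUTE-A.md §4 (B″)) solves the
transformed equation `Δu − (3/4)X⁻²u = X⁻¹ᐟ²·f` for `u = U/√X` and needs exactly the pointwise statement to
identify its solution with the flux function.

Contents (all PROVED, no named facts):
* (from `GradShafranovSqrtTransform`: `deriv_sqrt_mul` — `(√x·v)′ = v/(2√x) + √x·v′`);
* `hasDerivAt_inv_mul_deriv_sqrt_mul` — the derivative of `r ↦ r⁻¹·(√r·v)′(r)` at `R > 0`;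
* `radial_gs_sqrt_mul` — the one-variable core `R·(r ↦ r⁻¹(√r v)′)′(R) = √R·(v″(R) − (3/4)R⁻²v(R))`;
* `dZZ_sqrt_mul`, `gsOperator_sqrt_mul` — **`Δ*(√R·w)(R,Z) = √R·(w_RR + w_ZZ − (3/4)R⁻²w)`**;
* `gsOperator_sqrt_mul_eq_iff` — hence `Δ*(√R·w) = f ↔ w_RR + w_ZZ − (3/4)R⁻²w = f/√R` at `R > 0`.

Hypotheses are pointwise and minimal: `r ↦ w r Z` differentiable on a neighbourhood of `R` with its
derivative differentiable at `R` (so that `w_RR` is a genuine second derivative); NOTHING is assumed in `Z`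
(`∂²_Z(√R·w) = √R·∂²_Z w` holds unconditionally for Mathlib's `deriv`). WHAT THIS IS NOT: not the conformal
pull-back `Δ_ζ(u∘W) = |W′|²(Δu)∘W` (a separate classical fact); not a statement about solutions or domains.
[cite: Everitt2005SLCatalogue, §7 (The Liouville transformation), p = w = 1/R, q = 0, Q = 3/(4R²)]
-/

noncomputable section

open Real Filter
open _root_.Topology

namespace Literature.MathematicalPhysics.MHD

namespace GradShafranovSqrt

open Literature.MathematicalPhysics.MHD.GradShafranov

/-- Near `R > 0`, if `v` is differentiable on a neighbourhood of `R`, the function `r ↦ r⁻¹·(√r·v)′(r)` agrees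
with `r ↦ v r/(2(r√r)) + v′ r/√r` eventually. [cite: Everitt2005SLCatalogue, §7 (ii)] -/
theorem inv_mul_deriv_sqrt_mul_eventuallyEq {v : ℝ → ℝ} {R : ℝ} (hR : 0 < R)
    (hv : ∀ᶠ r in 𝓝 R, DifferentiableAt ℝ v r) :
    (fun r : ℝ => r⁻¹ * deriv (fun y => √y * v y) r) =ᶠ[𝓝 R]
      fun r => v r / (2 * (r * √r)) + deriv v r / √r := by
  have hpos : ∀ᶠ r in 𝓝 R, 0 < r := lt_mem_nhds hR
  filter_upwards [hv, hpos] with r hvr hr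
  rw [deriv_sqrt_mul hr hvr]
  have hs : 0 < √r := Real.sqrt_pos.mpr hr
  have hsq : √r ^ 2 = r := Real.sq_sqrt hr.le
  field_simp
  rw [hsq]
  ring

/-- Algebraic core in the variable `s = √R > 0` (`R = s²`): the derivative of `v/(2 r√r) + v′/√r` computed by the
product/quotient rules, multiplied by `R`, equals `s·(v″ − (3/4)v/R²)` (private helper; `a = v(R)`, `b = v′(R)`,
`c = v″(R)`, `d = (√·)′(R) = 1/(2s)`). [folklore] -/
private theorem radial_core_identity (s a b c : ℝ) (hs : 0 < s) :
    s ^ 2 * ((b * (2 * (s ^ 2 * s)) - a * (2 * (1 * s + s ^ 2 * (1 / (2 * s))))) / (2 * (s ^ 2 * s)) ^ 2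
        + (c * s - b * (1 / (2 * s))) / s ^ 2)
      = s * (c - 3 / 4 * (((s ^ 2) ^ 2)⁻¹ * a)) := by
  have hs0 : s ≠ 0 := hs.ne'
  field_simp
  ring

/-- **Radial core of the Liouville substitution (operator form).** For `R > 0` and `v` differentiable on a
neighbourhood of `R` with `v′` differentiable at `R`:
`R · d/dr[ r⁻¹ (√r·v)′ ](R) = √R · (v″(R) − (3/4) R⁻² v(R))` — the `R∂_R(R⁻¹∂_R ·)` part of `Δ*` applied to
`√R·v`. [cite: Everitt2005SLCatalogue, §7 (The Liouville transformation, p = w = 1/R, q = 0: Q = 3/(4R²))] -/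
theorem radial_gs_sqrt_mul {v : ℝ → ℝ} {R : ℝ} (hR : 0 < R)
    (hv : ∀ᶠ r in 𝓝 R, DifferentiableAt ℝ v r) (hv2 : DifferentiableAt ℝ (deriv v) R) :
    R * deriv (fun r : ℝ => r⁻¹ * deriv (fun y => √y * v y) r) R
      = √R * (deriv (deriv v) R - 3 / 4 * ((R ^ 2)⁻¹ * v R)) := by
  have hs : 0 < √R := Real.sqrt_pos.mpr hR
  have hsq : √R ^ 2 = R := Real.sq_sqrt hR.le
  have hvR : DifferentiableAt ℝ v R := hv.self_of_nhds
  -- derivative of the simplified expression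
  have hsqrt : HasDerivAt (fun r => √r) (1 / (2 * √R)) R := Real.hasDerivAt_sqrt hR.ne'
  have hid : HasDerivAt (fun r : ℝ => r) 1 R := hasDerivAt_id R
  have hden : HasDerivAt (fun r : ℝ => 2 * (r * √r)) (2 * (1 * √R + R * (1 / (2 * √R)))) R :=
    (hid.mul hsqrt).const_mul 2
  have hden0 : 2 * (R * √R) ≠ 0 := by positivity
  have h1 : HasDerivAt (fun r => v r / (2 * (r * √r)))
      ((deriv v R * (2 * (R * √R)) - v R * (2 * (1 * √R + R * (1 / (2 * √R))))) / (2 * (R * √R)) ^ 2) R :=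
    hvR.hasDerivAt.div hden hden0
  have h2 : HasDerivAt (fun r => deriv v r / √r)
      ((deriv (deriv v) R * √R - deriv v R * (1 / (2 * √R))) / √R ^ 2) R :=
    hv2.hasDerivAt.div hsqrt hs.ne'
  have hsum := h1.fun_add h2
  rw [(inv_mul_deriv_sqrt_mul_eventuallyEq hR hv).deriv_eq, hsum.deriv]
  -- pass to s = √R
  have key := radial_core_identity (√R) (v R) (deriv v R) (deriv (deriv v) R) hs
  rw [hsq] at key
  simpa only [hsq] using key

/-- `∂²_Z(√R·w)(R, Z) = √R · ∂²_Z w(R, Z)` — unconditionally (Mathlib's `deriv` of a constant multiple).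
[cite: Freidberg2014, §6.2.2 eq. (6.7)] -/
theorem dZZ_sqrt_mul (w : ℝ → ℝ → ℝ) (R Z : ℝ) :
    dZZ (fun r z => √r * w r z) R Z = √R * dZZ w R Z := by
  unfold dZZ
  show iteratedDeriv 2 (fun z => √R * w R z) Z = √R * iteratedDeriv 2 (w R) Z
  rw [show (2 : ℕ) = 1 + 1 from rfl, iteratedDeriv_succ, iteratedDeriv_one, iteratedDeriv_succ,
    iteratedDeriv_one]
  have h1 : deriv (fun z => √R * w R z) = fun z => √R * deriv (w R) z := by
    funext z
    exact deriv_const_mul_field (√R)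
  rw [h1, deriv_const_mul_field]

/-- **The Liouville substitution for `Δ*`, operator form.** For `R > 0` and `w : ℝ → ℝ → ℝ` such that
`r ↦ w r Z` is differentiable on a neighbourhood of `R` with derivative differentiable at `R`:
`Δ*(√R·w)(R, Z) = √R · (w_RR(R,Z) + w_ZZ(R,Z) − (3/4) R⁻² w(R,Z))`.
So `Δ*ψ = f` for `ψ = √R·w` is the flat-Laplacian equation `Δw − (3/4)R⁻²w = f/√R` — the form solved (after a
conformal change of variables) by the certnum (B″) enclosure. [cite: Everitt2005SLCatalogue, §7 (Liouville
transformation of (R⁻¹y′)′: Y = R^{-1/2}y, Q = 3/(4R²)); operator `Δ*` of Freidberg2014 eq. (6.7)] -/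
theorem gsOperator_sqrt_mul {w : ℝ → ℝ → ℝ} {R Z : ℝ} (hR : 0 < R)
    (hw : ∀ᶠ r in 𝓝 R, DifferentiableAt ℝ (fun s => w s Z) r)
    (hw2 : DifferentiableAt ℝ (deriv fun s => w s Z) R) :
    gsOperator (fun r z => √r * w r z) R Z
      = √R * (dRR w R Z + dZZ w R Z - 3 / 4 * ((R ^ 2)⁻¹ * w R Z)) := by
  have hrad := radial_gs_sqrt_mul (v := fun s => w s Z) hR hw hw2
  have hRR : dRR w R Z = deriv (deriv fun s => w s Z) R := by
    unfold dRR
    rw [show (2 : ℕ) = 1 + 1 from rfl, iteratedDeriv_succ, iteratedDeriv_one]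
  unfold gsOperator
  rw [dZZ_sqrt_mul, hRR]
  have hdR : (fun r => r⁻¹ * dR (fun r z => √r * w r z) r Z)
      = fun r : ℝ => r⁻¹ * deriv (fun y => √y * w y Z) r := by
    funext r; rfl
  rw [hdR, hrad]
  ring

/-- Hence, at `R > 0` (same differentiability hypotheses): **`Δ*(√R·w) = f ↔ w_RR + w_ZZ − (3/4)R⁻²w = f/√R`**
— e.g. for the normalised Solov'ev/Cerfon–Freidberg right-hand side `f = X²` the transformed equation reads
`Δu − (3/4)X⁻²u = X^{3/2}`. [cite: Everitt2005SLCatalogue, §7 (The Liouville transformation)] -/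
theorem gsOperator_sqrt_mul_eq_iff {w : ℝ → ℝ → ℝ} {R Z f : ℝ} (hR : 0 < R)
    (hw : ∀ᶠ r in 𝓝 R, DifferentiableAt ℝ (fun s => w s Z) r)
    (hw2 : DifferentiableAt ℝ (deriv fun s => w s Z) R) :
    gsOperator (fun r z => √r * w r z) R Z = f
      ↔ dRR w R Z + dZZ w R Z - 3 / 4 * ((R ^ 2)⁻¹ * w R Z) = f / √R := by
  rw [gsOperator_sqrt_mul hR hw hw2]
  have hs : 0 < √R := Real.sqrt_pos.mpr hR
  constructor
  · intro h
    rw [← h]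
    field_simp
  · intro h
    rw [h]
    field_simp

end GradShafranovSqrt

end Literature.MathematicalPhysics.MHD
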